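import Literature.Analysis.FluidPDE.PassiveVectorTensorL2WeakSlice
import Literature.Analysis.FluidPDE.PassiveVectorTensorUniqueness
import Literature.Analysis.FluidPDE.PassiveVectorL2WeakBound
import HarnessLib

/-!
# `L²` distributional solutions of the TENSOR passive-vector equation are in `L^∞_t L²_x`

Analysis/FluidPDE proof-support file (everything proved; no definitions). Tensor twin of
`PassiveVectorL2WeakBound`: the first pass of the Galerkin energy argument (Robinson–Rodrigo–Sadowski
2016, §4.2 (4.20)) run on an `L²((0,T) × T^d)` distributional solution of Frisch's
anisotropic-eddy-viscosity passive-vector equation `∂ₜw + (b·∇)w + ∇π = 𝓛_𝔸 w`, `∇·w = 0`, with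
`NearIso 𝔸 lo hi`, `0 < lo` (weak formulation against divergence-free space–time tests, bounded carrier,
divergence-free `L²` datum, divergence-free `L²` slices — the class produced by J.-L. Lions' theorem,
`PassiveVectorTensorLionsWeak` + `PassiveVectorLionsExtract`) yields the `L^∞_t L²_x` bound
`∫‖w(t)‖² ≤ ‖w₀‖² + (2d²M²/lo)‖w‖²_{L²(μ_T)}` for a.e. `t` (`ae_integral_norm_sq_le_of_weakT`). New
ingredients relative to the scalar file: the linearity of the tensor flux in the test field
(`sum_mul_tensorFlux_eq`) and the truncated Gårding inequality
`∫⟪w, 𝓛_𝔸^* P_N w⟫ ≤ -lo ‖∇P_N w‖₂²` for a weakly divergence-free `L²` slice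
(`integral_inner_viscAdj_fourierTruncate_le`; transversal modes, `lo_mul_le_re_inner_symbT`).

## References

* J. C. Robinson, J. L. Rodrigo, W. Sadowski, *The three-dimensional Navier–Stokes equations* (CUP 2016),
  §4.2 (4.20). [`RobinsonRodrigoSadowski2016`]
* R. Temam, *Navier–Stokes Equations*, 3rd ed. (1984), Ch. III §1, Thm. 1.1, Lemma 1.2. [`Temam1984`]
* M. Giaquinta, *Multiple integrals in the calculus of variations* (Princeton 1983), Ch. III §2. [`Giaquinta1983MultipleIntegrals`]
-/

noncomputable section

open MeasureTheory Set Filter Function TopologicalSpace Complex UnitAddTorus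
open scoped ENNReal NNReal InnerProductSpace Topology ComplexConjugate

namespace Literature.Analysis.FluidPDE

namespace Torus

variable {d : Type*} [Fintype d] [DecidableEq d]

/-! ## The tensor flux is linear in the test field; truncated Gårding -/

/-- `viscAdj 𝔸` over a finite linear combination of smooth fields (and smoothness of the combination).
[folklore] -/
private theorem viscAdj_finset_sum_smul_T4 {ι : Type*} (𝔸 : Visc4 d) (s : Finset ι) (c : ι → ℝ)
    {a : ι → UnitAddTorus d → EuclideanSpace ℝ d} (ha : ∀ i, FunctionSpaces.Torus.IsSmooth (a i)) (x : UnitAddTorus d) :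
    viscAdj 𝔸 (fun y => ∑ i ∈ s, c i • a i y) x = ∑ i ∈ s, c i • viscAdj 𝔸 (a i) x := by
  classical
  induction s using Finset.induction_on with
  | empty =>
    simp only [Finset.sum_empty]
    exact viscAdj_zero_field 𝔸 x
  | insert j s hj ih =>
    have e : (fun y => ∑ i ∈ insert j s, c i • a i y) = (c j • a j) + fun y => ∑ i ∈ s, c i • a i y := by
      funext y; rw [Finset.sum_insert hj]; rfl
    rw [e, viscAdj_add_field 𝔸 ((ha j).smul (c j)) (isSmooth_finset_sum_smul s c ha) x, ih,
      viscAdj_const_smul_field 𝔸 (ha j), Finset.sum_insert hj]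

/-- **Linearity of the tensor flux in the test field**: for smooth `aᵢ`, reals `cᵢ` and
`Ψ = ∑ᵢ cᵢ aᵢ`, `∑ᵢ cᵢ ∫⟪v,(u·∇)aᵢ + 𝓛_𝔸^*aᵢ⟫ = ∫⟪v,(u·∇)Ψ + 𝓛_𝔸^*Ψ⟫` (`v` integrable, products
`uⱼ v` integrable). [cite: RobinsonRodrigoSadowski2016, §4.1 (Galerkin truncations)] -/
theorem sum_mul_tensorFlux_eq {ι : Type*} (I : Finset ι) (c : ι → ℝ)
    {a : ι → UnitAddTorus d → EuclideanSpace ℝ d} (ha : ∀ i, FunctionSpaces.Torus.IsSmooth (a i)) (𝔸 : Visc4 d)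
    {u v : UnitAddTorus d → EuclideanSpace ℝ d} (hv : Integrable v volume)
    (huv : ∀ j, Integrable (fun x => u x j • v x) volume) :
    ∑ i ∈ I, c i * ∫ x, ⟪v x, FunctionSpaces.Torus.convect u (a i) x + viscAdj 𝔸 (a i) x⟫_ℝ =
      ∫ x, ⟪v x, FunctionSpaces.Torus.convect u (fun y => ∑ i ∈ I, c i • a i y) x +
          viscAdj 𝔸 (fun y => ∑ i ∈ I, c i • a i y) x⟫_ℝ := by
  have hΨ : FunctionSpaces.Torus.IsSmooth (fun y => ∑ i ∈ I, c i • a i y) := isSmooth_finset_sum_smul I c ha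
  have iV : ∀ {Φ : UnitAddTorus d → EuclideanSpace ℝ d}, FunctionSpaces.Torus.IsSmooth Φ →
      Integrable (fun x => ⟪v x, viscAdj 𝔸 Φ x⟫_ℝ) volume := fun hΦ =>
    FunctionSpaces.Torus.integrable_inner_of_continuous hv (isSmooth_viscAdj 𝔸 hΦ).continuous
  have split : ∀ {Φ : UnitAddTorus d → EuclideanSpace ℝ d}, FunctionSpaces.Torus.IsSmooth Φ →
      ∫ x, ⟪v x, FunctionSpaces.Torus.convect u Φ x + viscAdj 𝔸 Φ x⟫_ℝ =
        (∫ x, ⟪v x, FunctionSpaces.Torus.convect u Φ x⟫_ℝ) + ∫ x, ⟪v x, viscAdj 𝔸 Φ x⟫_ℝ := by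
    intro Φ hΦ
    rw [← integral_add (integrable_inner_convect_of_integrable_smul huv hΦ) (iV hΦ)]
    exact integral_congr_ae (ae_of_all _ fun x => inner_add_right _ _ _)
  rw [split hΨ, ← sum_mul_integral_inner_convect_eq I c ha huv]
  have hvisc : ∑ i ∈ I, c i * ∫ x, ⟪v x, viscAdj 𝔸 (a i) x⟫_ℝ =
      ∫ x, ⟪v x, viscAdj 𝔸 (fun y => ∑ i ∈ I, c i • a i y) x⟫_ℝ := by
    simp_rw [← integral_const_mul]
    rw [← integral_finsetSum I fun i _ => (iV (ha i)).const_mul _]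
    refine integral_congr_ae (ae_of_all _ fun x => ?_)
    dsimp only
    rw [viscAdj_finset_sum_smul_T4 𝔸 I c ha x, inner_sum]
    exact Finset.sum_congr rfl fun i _ => by rw [real_inner_smul_right]
  simp_rw [split (ha _)]
  rw [Finset.sum_congr rfl fun i _ => mul_add (c i) _ _, Finset.sum_add_distrib, hvisc]

/-- **Truncated Gårding inequality for a weakly divergence-free `L²` slice**: for `NearIso 𝔸 lo hi`,
`∫⟪v, 𝓛_𝔸^* P_N v⟫ ≤ -lo ‖∇P_N v‖₂²` (`P_N v = ∑` single real modes, the single-mode symbol,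
transversality of the modes of `v`). [cite: Giaquinta1983MultipleIntegrals, Ch. III §2 eq. (2.2)–(2.6)] -/
theorem integral_inner_viscAdj_fourierTruncate_le {𝔸 : Visc4 d} {lo hi : ℝ} (h𝔸 : NearIso 𝔸 lo hi)
    {v : UnitAddTorus d → EuclideanSpace ℝ d} (hv : MemLp v 2 volume) (hdiv : FunctionSpaces.Torus.IsWeaklyDivFree v)
    (N : ℕ) :
    ∫ x, ⟪v x, viscAdj 𝔸 (FunctionSpaces.Torus.fourierTruncate N v) x⟫_ℝ ≤
      -(lo * (FunctionSpaces.Torus.eGradNormSq (FunctionSpaces.Torus.fourierTruncate N v)).toReal) := by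
  have hvi : Integrable v volume := hv.integrable one_le_two
  set c : (d → ℤ) → EuclideanSpace ℂ d := fun k => mFourierCoeff (FunctionSpaces.EuclideanSpace.complexify ∘ v) k with hc
  have hsing : ∀ k : d → ℤ, FunctionSpaces.Torus.IsSmooth (FunctionSpaces.Torus.realTrigPoly {k} c) :=
    fun k => FunctionSpaces.Torus.isSmooth_realTrigPoly _ _
  have hPsum : FunctionSpaces.Torus.fourierTruncate N v =
      fun y => ∑ k ∈ FunctionSpaces.Torus.freqBall N, (1 : ℝ) • FunctionSpaces.Torus.realTrigPoly {k} c y := by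
    funext y
    rw [FunctionSpaces.Torus.fourierTruncate_eq, FunctionSpaces.Torus.realTrigPoly_apply_eq_sum]
    refine Finset.sum_congr rfl fun k _ => ?_
    rw [one_smul, FunctionSpaces.Torus.realTrigPoly_apply_eq_sum, Finset.sum_singleton]
  have h1 : ∫ x, ⟪v x, viscAdj 𝔸 (FunctionSpaces.Torus.fourierTruncate N v) x⟫_ℝ =
      ∑ k ∈ FunctionSpaces.Torus.freqBall N, ((-(4 * Real.pi ^ 2 : ℝ) : ℂ) * ⟪c k, symbT 𝔸 k (c k)⟫_ℂ).re := by
    have hadd : ∀ x, ⟪v x, viscAdj 𝔸 (FunctionSpaces.Torus.fourierTruncate N v) x⟫_ℝ =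
        ∑ k ∈ FunctionSpaces.Torus.freqBall N, ⟪v x, viscAdj 𝔸 (FunctionSpaces.Torus.realTrigPoly {k} c) x⟫_ℝ := by
      intro x
      rw [hPsum, viscAdj_finset_sum_smul_T4 𝔸 _ _ hsing x, inner_sum]
      exact Finset.sum_congr rfl fun k _ => by rw [one_smul]
    simp_rw [hadd]
    rw [integral_finsetSum _ fun k _ =>
      FunctionSpaces.Torus.integrable_inner_of_continuous hvi (isSmooth_viscAdj 𝔸 (hsing k)).continuous]
    exact Finset.sum_congr rfl fun k _ => integral_inner_viscAdj_realTrigPoly_singleton hvi 𝔸 k c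
  rw [h1, FunctionSpaces.Torus.fourierTruncate_eq,
    FunctionSpaces.Torus.toReal_eGradNormSq_realTrigPoly FunctionSpaces.Torus.neg_mem_freqBall_of_mem
      (FunctionSpaces.Torus.isConjSymm_mFourierCoeff hvi),
    ← mul_assoc, mul_comm lo, mul_assoc, Finset.mul_sum, ← neg_mul, Finset.mul_sum]
  refine Finset.sum_le_sum fun k _ => ?_
  rw [neg_mul, Complex.neg_re, Complex.re_ofReal_mul, neg_mul]
  have h := lo_mul_le_re_inner_symbT h𝔸 (hdiv.sum_mul_mFourierCoeff_eq_zero hv k)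
  have h' := mul_le_mul_of_nonneg_left h (by positivity : (0 : ℝ) ≤ 4 * Real.pi ^ 2)
  linarith

section L2Bound

variable {T : ℝ} {𝔸 : Visc4 d} {b w : ℝ → UnitAddTorus d → EuclideanSpace ℝ d} {w₀ : UnitAddTorus d → EuclideanSpace ℝ d}

omit [Fintype d] [DecidableEq d] in
/-- Product rule for an a.e. primitive with datum: `U(t) = c + ∫_{(0,t]} F` a.e. with `F ∈ L¹(0,T)` gives
`U(t)² = c² + 2 ∫_{(0,t]} F U` a.e. (copy of the private lemma of `PassiveVectorModeEnergy`). [folklore] -/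
private theorem ae_sq_eq_of_ae_eq_add_setIntegral_T4 {T c : ℝ} {U F : ℝ → ℝ} (hF : IntegrableOn F (Ioo 0 T) volume)
    (hU : ∀ᵐ t ∂(volume.restrict (Ioo 0 T)), U t = c + ∫ τ in Ioc 0 t, F τ) :
    ∀ᵐ t ∂(volume.restrict (Ioo 0 T)), U t ^ 2 = c ^ 2 + 2 * ∫ τ in Ioc 0 t, F τ * U τ := by
  have hU' : ∀ᵐ τ ∂(volume : Measure ℝ), τ ∈ Ioo 0 T → U τ = c + ∫ r in Ioc 0 τ, F r :=
    (ae_restrict_iff' measurableSet_Ioo).1 hU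
  filter_upwards [hU, ae_restrict_mem measurableSet_Ioo] with t ht htT
  have hsub : Ioc 0 t ⊆ Ioo 0 T := Ioc_subset_Ioo_right htT.2
  rw [ht, sq_const_add_setIntegral_eq (hF.mono_set hsub)]
  congr 1
  congr 1
  refine setIntegral_congr_ae measurableSet_Ioc ?_
  filter_upwards [hU'] with τ hτ hτI
  rw [hτ (hsub hτI)]

omit [Fintype d] [DecidableEq d] in
/-- If `U = c + ∫_{(0,·]} F` a.e. with `F ∈ L¹(0,T)`, then `F U` is integrable on `(0,T)` (the primitive is
bounded by `|c| + ‖F‖₁`). [folklore] -/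
private theorem integrableOn_mul_of_ae_eq_add_setIntegral_T4 {T c : ℝ} {U F : ℝ → ℝ} (hF : IntegrableOn F (Ioo 0 T) volume)
    (hUm : AEStronglyMeasurable U (volume.restrict (Ioo 0 T)))
    (hU : ∀ᵐ t ∂(volume.restrict (Ioo 0 T)), U t = c + ∫ τ in Ioc 0 t, F τ) :
    IntegrableOn (fun t => F t * U t) (Ioo 0 T) := by
  set B : ℝ := |c| + ∫ τ in Ioo 0 T, |F τ| with hB
  refine Integrable.mono' (hF.norm.mul_const B) (hF.aestronglyMeasurable.mul hUm) ?_
  filter_upwards [hU, ae_restrict_mem measurableSet_Ioo] with t ht htI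
  rw [norm_mul, ht, Real.norm_eq_abs, Real.norm_eq_abs]
  refine mul_le_mul_of_nonneg_left ?_ (abs_nonneg _)
  calc |c + ∫ τ in Ioc 0 t, F τ| ≤ |c| + |∫ τ in Ioc 0 t, F τ| := abs_add_le _ _
    _ ≤ |c| + ∫ τ in Ioc 0 t, |F τ| := by gcongr; exact abs_integral_le_integral_abs
    _ ≤ |c| + ∫ τ in Ioo 0 T, |F τ| :=
        add_le_add le_rfl (setIntegral_mono_set hF.abs (ae_of_all _ fun τ => abs_nonneg _)
          (Ioc_subset_Ioo_right htI.2).eventuallyLE)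

/-- **`L²` distributional solutions of the passive solenoidal vector equation are in `L^∞_t L²_x`.** Let
`w ∈ L²((0,T) × T^d)` have weakly divergence-free `L²` slices for a.e. `t`, let the carrier satisfy `‖b‖ ≤ M`
a.e. on `(0,T) × T^d` with `b(t)` weakly divergence free for a.e. `t`, let `w₀ ∈ L²` be weakly divergence free,
`NearIso 𝔸 lo hi` with `lo > 0`, and let the weak formulation hold against all divergence-free space–time tests (product form). Then
for a.e. `t ∈ (0,T)`, `∫‖w(t)‖² ≤ ∫‖w₀‖² + (2(dM)²/lo) ∫_{μ_T}‖w‖²` (first pass of the truncated energy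
identity; Robinson–Rodrigo–Sadowski 2016, (4.20)). [cite: RobinsonRodrigoSadowski2016, §4.2 (4.20)] -/
theorem ae_integral_norm_sq_le_of_weakT {lo hi : ℝ} (h𝔸 : NearIso 𝔸 lo hi) (hlo : 0 < lo)
    (hw2 : MemLp (uncurry w) 2 (((volume : Measure ℝ).restrict (Ioo 0 T)).prod volume))
    (hw2s : ∀ᵐ t ∂(volume.restrict (Ioo 0 T)), MemLp (w t) 2 volume)
    (hdivw : ∀ᵐ t ∂(volume.restrict (Ioo 0 T)), FunctionSpaces.Torus.IsWeaklyDivFree (w t))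
    (hbm : AEStronglyMeasurable (uncurry b) (((volume : Measure ℝ).restrict (Ioo 0 T)).prod volume)) {M : ℝ}
    (hM : 0 ≤ M)
    (hbM : ∀ᵐ p ∂(((volume : Measure ℝ).restrict (Ioo 0 T)).prod (volume : Measure (UnitAddTorus d))), ‖uncurry b p‖ ≤ M)
    (hbdiv : ∀ᵐ t ∂(volume.restrict (Ioo 0 T)), FunctionSpaces.Torus.IsWeaklyDivFree (b t))
    (hweak : ∀ Ψ : ℝ → UnitAddTorus d → EuclideanSpace ℝ d, FunctionSpaces.Torus.IsSpaceTimeTest T Ψ →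
      (∀ t, FunctionSpaces.Torus.IsDivFree (Ψ t)) →
      (∫ p, ⟪w p.1 p.2, FunctionSpaces.Torus.timeDeriv Ψ p.1 p.2 +
          FunctionSpaces.Torus.convect (b p.1) (Ψ p.1) p.2 + viscAdj 𝔸 (Ψ p.1) p.2⟫_ℝ
          ∂(((volume : Measure ℝ).restrict (Ioo 0 T)).prod volume)) + ∫ x, ⟪w₀ x, Ψ 0 x⟫_ℝ = 0)
    (hw₀ : MemLp w₀ 2 volume) (hdiv₀ : FunctionSpaces.Torus.IsWeaklyDivFree w₀) :
    ∀ᵐ t ∂(volume.restrict (Ioo 0 T)),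
      ∫ x, ‖w t x‖ ^ 2 ≤ (∫ x, ‖w₀ x‖ ^ 2) +
        2 * ((Fintype.card d * M) ^ 2 / lo) *
          ∫ p, ‖uncurry w p‖ ^ 2 ∂(((volume : Measure ℝ).restrict (Ioo 0 T)).prod volume) := by
  classical
  set μ : Measure (ℝ × UnitAddTorus d) := ((volume : Measure ℝ).restrict (Ioo 0 T)).prod volume with hμ
  set C : ℝ := Fintype.card d * M with hC
  have hC0 : 0 ≤ C := by positivity
  -- ### integrability bookkeeping
  have hw1 : Integrable (uncurry w) μ := hw2.integrable one_le_two
  have hbw : Integrable (fun p : ℝ × UnitAddTorus d => ‖b p.1 p.2‖ * ‖w p.1 p.2‖) μ := by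
    refine Integrable.mono' (hw1.norm.const_mul M) (hbm.norm.mul hw1.1.norm) ?_
    filter_upwards [hbM] with p hp
    rw [Real.norm_eq_abs, abs_of_nonneg (mul_nonneg (norm_nonneg _) (norm_nonneg _))]
    exact mul_le_mul_of_nonneg_right hp (norm_nonneg _)
  have hbMt : ∀ᵐ t ∂(volume.restrict (Ioo 0 T)), ∀ᵐ x ∂volume, ‖b t x‖ ≤ M := Measure.ae_ae_of_ae_prod hbM
  have hbmt : ∀ᵐ t ∂(volume.restrict (Ioo 0 T)), AEStronglyMeasurable (b t) volume := hbm.prodMk_left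
  -- good times: slices and products
  have hgood : ∀ᵐ t ∂(volume.restrict (Ioo 0 T)), MemLp (w t) 2 volume ∧ FunctionSpaces.Torus.IsWeaklyDivFree (w t) ∧
      Integrable (b t) volume ∧ FunctionSpaces.Torus.IsWeaklyDivFree (b t) ∧ (∀ᵐ x ∂volume, ‖b t x‖ ≤ M) ∧
      (∀ j, Integrable (fun x => b t x j • w t x) volume) ∧ (∀ j, Integrable (fun x => w t x j • b t x) volume) := by
    filter_upwards [hw2s, hdivw, hbMt, hbmt, hbdiv] with t h2 hdw hbx hbs hbd
    have hbint : Integrable (b t) volume := Integrable.of_bound hbs M hbx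
    have hwi : Integrable (w t) volume := h2.integrable one_le_two
    refine ⟨h2, hdw, hbint, hbd, hbx, fun j => ?_, fun j => ?_⟩
    · refine Integrable.mono' (hwi.norm.const_mul M)
        (((EuclideanSpace.proj j).continuous.comp_aestronglyMeasurable hbs).smul h2.1) ?_
      filter_upwards [hbx] with x hx
      rw [norm_smul]
      have hj : ‖b t x j‖ ≤ ‖b t x‖ := by simpa [Real.norm_eq_abs] using FunctionSpaces.Torus.abs_apply_le_norm (b t x) j
      exact mul_le_mul (hj.trans hx) le_rfl (norm_nonneg _) hM
    · refine Integrable.mono' (hwi.norm.mul_const M)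
        (((EuclideanSpace.proj j).continuous.comp_aestronglyMeasurable h2.1).smul hbs) ?_
      filter_upwards [hbx] with x hx
      rw [norm_smul]
      exact mul_le_mul (by simpa [Real.norm_eq_abs] using FunctionSpaces.Torus.abs_apply_le_norm (w t x) j) hx
        (norm_nonneg _) (norm_nonneg _)
  -- ### the frame and the coefficient functions
  set I : ℕ → Finset ((d → ℤ) × d × Bool) := fun N =>
    FunctionSpaces.Torus.freqBall N ×ˢ ((Finset.univ : Finset d) ×ˢ (Finset.univ : Finset Bool)) with hI
  set a : (d → ℤ) × d × Bool → UnitAddTorus d → EuclideanSpace ℝ d := fun i => frameField i.1 i.2.1 i.2.2 with ha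
  have ha_smooth : ∀ i, FunctionSpaces.Torus.IsSmooth (a i) := fun i => isSmooth_frameField _ _ _
  have ha_div : ∀ i, FunctionSpaces.Torus.IsDivFree (a i) := fun i => isDivFree_frameField' _ _ _
  have ha_cont : ∀ i, Continuous (a i) := fun i => continuous_frameField _ _ _
  set U : (d → ℤ) × d × Bool → ℝ → ℝ := fun i t => ∫ x, ⟪w t x, a i x⟫_ℝ with hU
  set φ : (d → ℤ) × d × Bool → ℝ → ℝ := fun i τ =>
    ∫ x, ⟪w τ x, FunctionSpaces.Torus.convect (b τ) (a i) x + viscAdj 𝔸 (a i) x⟫_ℝ with hφ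
  have hslice := fun i => ae_integral_inner_eq_of_weakT 𝔸 hw1 hbm hbw hweak (ha_smooth i) (ha_div i)
  have hφint : ∀ i, IntegrableOn (φ i) (Ioo 0 T) := fun i => (hslice i).1
  have hUm : ∀ i, AEStronglyMeasurable (U i) (volume.restrict (Ioo 0 T)) := by
    intro i
    have hc : Continuous (uncurry fun (_ : ℝ) (x : UnitAddTorus d) => a i x) := (ha_cont i).comp continuous_snd
    exact (integrable_inner_of_integrable_of_continuous hw1 hc).integral_prod_left.aestronglyMeasurable
  -- the one-mode identities and their squares
  have hsq : ∀ i, ∀ᵐ t ∂(volume.restrict (Ioo 0 T)),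
      U i t ^ 2 = (∫ x, ⟪w₀ x, a i x⟫_ℝ) ^ 2 + 2 * ∫ τ in Ioc 0 t, φ i τ * U i τ := fun i =>
    ae_sq_eq_of_ae_eq_add_setIntegral_T4 (hφint i) (hslice i).2
  have hφU : ∀ i, IntegrableOn (fun t => φ i t * U i t) (Ioo 0 T) := fun i =>
    integrableOn_mul_of_ae_eq_add_setIntegral_T4 (hφint i) (hUm i) (hslice i).2
  -- ### the slice energy `s ↦ ∫‖w s‖²` is integrable, with integral `∫_μ ‖w‖²`
  have hE2 : IntegrableOn (fun s => ∫ x, ‖w s x‖ ^ 2) (Ioo 0 T) := (hw2.integrable_norm_pow two_ne_zero).integral_prod_left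
  have hE2eq : ∫ s in Ioo 0 T, ∫ x, ‖w s x‖ ^ 2 = ∫ p, ‖uncurry w p‖ ^ 2 ∂μ := by
    rw [hμ, integral_prod _ (hw2.integrable_norm_pow two_ne_zero)]
    rfl
  -- ### the summed integrand is bounded by `(C²/lo) ∫‖w(τ)‖²`, a.e.
  have hbound : ∀ N, ∀ᵐ τ ∂(volume.restrict (Ioo 0 T)),
      ∑ i ∈ I N, φ i τ * U i τ ≤ C ^ 2 / lo * ∫ x, ‖w τ x‖ ^ 2 := by
    intro N
    filter_upwards [hgood] with τ hg
    obtain ⟨h2, hdw, hbint, hbd, hbx, hprod1, hprod2⟩ := hg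
    have hwi : Integrable (w τ) volume := h2.integrable one_le_two
    -- the sum is the flux against the own truncation
    have hsum : ∑ i ∈ I N, φ i τ * U i τ =
        ∫ x, ⟪w τ x, FunctionSpaces.Torus.convect (b τ) (FunctionSpaces.Torus.fourierTruncate N (w τ)) x +
          viscAdj 𝔸 (FunctionSpaces.Torus.fourierTruncate N (w τ)) x⟫_ℝ := by
      calc ∑ i ∈ I N, φ i τ * U i τ
          = ∑ i ∈ I N, U i τ * ∫ x, ⟪w τ x, FunctionSpaces.Torus.convect (b τ) (a i) x + viscAdj 𝔸 (a i) x⟫_ℝ := by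
            refine Finset.sum_congr rfl fun i _ => ?_
            simp only [hφ]
            ring
        _ = _ := sum_mul_tensorFlux_eq (I N) (fun i => U i τ) ha_smooth 𝔸 hwi hprod1
        _ = _ := by rw [fourierTruncate_eq_sum_integral_inner_smul_frameField h2 hdw N]
    have hPs := FunctionSpaces.Torus.isSmooth_fourierTruncate N (w τ)
    have hsplit : ∫ x, ⟪w τ x, FunctionSpaces.Torus.convect (b τ) (FunctionSpaces.Torus.fourierTruncate N (w τ)) x +
          viscAdj 𝔸 (FunctionSpaces.Torus.fourierTruncate N (w τ)) x⟫_ℝ =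
        (∫ x, ⟪w τ x, FunctionSpaces.Torus.convect (b τ) (FunctionSpaces.Torus.fourierTruncate N (w τ)) x⟫_ℝ) +
          ∫ x, ⟪w τ x, viscAdj 𝔸 (FunctionSpaces.Torus.fourierTruncate N (w τ)) x⟫_ℝ := by
      rw [← integral_add (integrable_inner_convect_of_integrable_smul hprod1 hPs)
        (FunctionSpaces.Torus.integrable_inner_of_continuous hwi (isSmooth_viscAdj 𝔸 hPs).continuous)]
      exact integral_congr_ae (ae_of_all _ fun x => inner_add_right _ _ _)
    have hvisc := integral_inner_viscAdj_fourierTruncate_le h𝔸 h2 hdw N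
    rw [hsum, hsplit, integral_inner_convect_fourierTruncate_eq_remainder hbint hbd hprod1 N]
    -- the remainder bound and Young
    have hv : MemLp (fun x => w τ x - FunctionSpaces.Torus.fourierTruncate N (w τ) x) 2 volume :=
      h2.sub (FunctionSpaces.Torus.memLp_fourierTruncate N _ 2)
    have hR := abs_integral_inner_convect_le_of_norm_le (u := b τ) hv hM hbx
      (FunctionSpaces.Torus.isSmooth_fourierTruncate N (w τ))
    rw [gradNormSq_fourierTruncate] at hR
    set Rv := ∫ x, ⟪w τ x - FunctionSpaces.Torus.fourierTruncate N (w τ) x,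
      FunctionSpaces.Torus.convect (b τ) (FunctionSpaces.Torus.fourierTruncate N (w τ)) x⟫_ℝ with hRv
    set tl := ∫ x, ‖w τ x - FunctionSpaces.Torus.fourierTruncate N (w τ) x‖ ^ 2 with htl
    set D := (FunctionSpaces.Torus.eGradNormSq (FunctionSpaces.Torus.fourierTruncate N (w τ))).toReal with hD
    have htl0 : 0 ≤ tl := integral_nonneg fun x => sq_nonneg _
    have hD0 : 0 ≤ D := ENNReal.toReal_nonneg
    -- tail bound `tl ≤ 4 ∫‖w τ‖²`
    have htail : tl ≤ 4 * ∫ x, ‖w τ x‖ ^ 2 := by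
      have hP : MemLp (FunctionSpaces.Torus.fourierTruncate N (w τ)) 2 volume := FunctionSpaces.Torus.memLp_fourierTruncate N _ 2
      have hpt : ∀ x, ‖w τ x - FunctionSpaces.Torus.fourierTruncate N (w τ) x‖ ^ 2 ≤
          2 * ‖w τ x‖ ^ 2 + 2 * ‖FunctionSpaces.Torus.fourierTruncate N (w τ) x‖ ^ 2 := fun x => by
        have h1 : ‖w τ x - FunctionSpaces.Torus.fourierTruncate N (w τ) x‖ ^ 2 ≤
            (‖w τ x‖ + ‖FunctionSpaces.Torus.fourierTruncate N (w τ) x‖) ^ 2 :=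
          pow_le_pow_left₀ (norm_nonneg _) (norm_sub_le _ _) 2
        nlinarith [h1, sq_nonneg (‖w τ x‖ - ‖FunctionSpaces.Torus.fourierTruncate N (w τ) x‖)]
      have i1 := h2.integrable_norm_pow two_ne_zero
      have i2 := hP.integrable_norm_pow two_ne_zero
      calc tl ≤ ∫ x, (2 * ‖w τ x‖ ^ 2 + 2 * ‖FunctionSpaces.Torus.fourierTruncate N (w τ) x‖ ^ 2) :=
            integral_mono_of_nonneg (ae_of_all _ fun x => sq_nonneg _) ((i1.const_mul 2).add (i2.const_mul 2)) (ae_of_all _ hpt)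
        _ = 2 * (∫ x, ‖w τ x‖ ^ 2) + 2 * (∫ x, ‖FunctionSpaces.Torus.fourierTruncate N (w τ) x‖ ^ 2) := by
            rw [integral_add (i1.const_mul 2) (i2.const_mul 2), integral_const_mul, integral_const_mul]
        _ ≤ 2 * (∫ x, ‖w τ x‖ ^ 2) + 2 * (∫ x, ‖w τ x‖ ^ 2) :=
            add_le_add le_rfl (mul_le_mul_of_nonneg_left (FunctionSpaces.Torus.integral_norm_sq_fourierTruncate_le h2 N) (by norm_num))
        _ = 4 * ∫ x, ‖w τ x‖ ^ 2 := by ring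
    -- Young: `C √tl √D ≤ C² tl/(4lo) + lo D`
    have hyoung : C * Real.sqrt tl * Real.sqrt D ≤ C ^ 2 / (4 * lo) * tl + lo * D := by
      have hst := Real.sq_sqrt htl0
      have hsD := Real.sq_sqrt hD0
      rw [show C ^ 2 / (4 * lo) * tl + lo * D = (C ^ 2 * tl + 4 * lo ^ 2 * D) / (4 * lo) by field_simp,
        le_div_iff₀ (by positivity)]
      nlinarith [sq_nonneg (C * Real.sqrt tl - 2 * lo * Real.sqrt D), hst, hsD]
    have hRle : Rv ≤ C * Real.sqrt tl * Real.sqrt D := (le_abs_self _).trans hR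
    calc Rv + ∫ x, ⟪w τ x, viscAdj 𝔸 (FunctionSpaces.Torus.fourierTruncate N (w τ)) x⟫_ℝ
        ≤ Rv - lo * D := by linarith
      _ ≤ C ^ 2 / (4 * lo) * tl := by linarith
      _ ≤ C ^ 2 / (4 * lo) * (4 * ∫ x, ‖w τ x‖ ^ 2) := mul_le_mul_of_nonneg_left htail (by positivity)
      _ = C ^ 2 / lo * ∫ x, ‖w τ x‖ ^ 2 := by field_simp
  -- ### assemble at a.e. `t`
  have hsq' : ∀ᵐ t ∂(volume.restrict (Ioo 0 T)), ∀ i,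
      U i t ^ 2 = (∫ x, ⟪w₀ x, a i x⟫_ℝ) ^ 2 + 2 * ∫ τ in Ioc 0 t, φ i τ * U i τ := ae_all_iff.2 hsq
  have hbound' : ∀ N, ∀ᵐ τ ∂(volume : Measure ℝ), τ ∈ Ioo 0 T →
      ∑ i ∈ I N, φ i τ * U i τ ≤ C ^ 2 / lo * ∫ x, ‖w τ x‖ ^ 2 := fun N =>
    (ae_restrict_iff' measurableSet_Ioo).1 (hbound N)
  have h0 : ∀ N, ∑ i ∈ I N, (∫ x, ⟪w₀ x, a i x⟫_ℝ) ^ 2 ≤ ∫ x, ‖w₀ x‖ ^ 2 := by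
    intro N
    have h := integral_inner_fourierTruncate_fourierTruncate_eq_sum hw₀ hw₀ hdiv₀ N
    have hB := FunctionSpaces.Torus.integral_norm_sq_fourierTruncate_le hw₀ N
    have e : ∫ x, ⟪FunctionSpaces.Torus.fourierTruncate N w₀ x, FunctionSpaces.Torus.fourierTruncate N w₀ x⟫_ℝ =
        ∫ x, ‖FunctionSpaces.Torus.fourierTruncate N w₀ x‖ ^ 2 :=
      integral_congr_ae (ae_of_all _ fun x => real_inner_self_eq_norm_sq _)
    calc ∑ i ∈ I N, (∫ x, ⟪w₀ x, a i x⟫_ℝ) ^ 2 = ∑ i ∈ I N, (∫ x, ⟪w₀ x, a i x⟫_ℝ) * ∫ x, ⟪w₀ x, a i x⟫_ℝ :=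
          Finset.sum_congr rfl fun i _ => sq _
      _ = ∫ x, ‖FunctionSpaces.Torus.fourierTruncate N w₀ x‖ ^ 2 := by rw [← h, e]
      _ ≤ ∫ x, ‖w₀ x‖ ^ 2 := hB
  filter_upwards [hsq', hgood, ae_restrict_mem measurableSet_Ioo] with t ht hg htI
  obtain ⟨h2, hdw, -⟩ := hg
  have hsub : Ioc 0 t ⊆ Ioo 0 T := Ioc_subset_Ioo_right htI.2
  -- the truncated energies are bounded, uniformly in `N`
  have hEN : ∀ N, ∫ x, ⟪FunctionSpaces.Torus.fourierTruncate N (w t) x, FunctionSpaces.Torus.fourierTruncate N (w t) x⟫_ℝ ≤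
      (∫ x, ‖w₀ x‖ ^ 2) + 2 * (C ^ 2 / lo) * ∫ p, ‖uncurry w p‖ ^ 2 ∂μ := by
    intro N
    rw [integral_inner_fourierTruncate_fourierTruncate_eq_sum h2 h2 hdw N]
    have hsumI' : IntegrableOn (fun τ => ∑ i ∈ I N, φ i τ * U i τ) (Ioo 0 T) :=
      integrable_finsetSum (I N) fun i _ => hφU i
    have hsumI : IntegrableOn (fun τ => ∑ i ∈ I N, φ i τ * U i τ) (Ioc 0 t) := hsumI'.mono_set hsub
    calc ∑ i ∈ I N, (U i t) * (U i t)
        = ∑ i ∈ I N, ((∫ x, ⟪w₀ x, a i x⟫_ℝ) ^ 2 + 2 * ∫ τ in Ioc 0 t, φ i τ * U i τ) :=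
          Finset.sum_congr rfl fun i _ => by rw [← sq, ht i]
      _ = (∑ i ∈ I N, (∫ x, ⟪w₀ x, a i x⟫_ℝ) ^ 2) + 2 * ∫ τ in Ioc 0 t, ∑ i ∈ I N, φ i τ * U i τ := by
          rw [Finset.sum_add_distrib, integral_finsetSum (I N) fun i _ => (hφU i).mono_set hsub, Finset.mul_sum]
      _ ≤ (∫ x, ‖w₀ x‖ ^ 2) + 2 * ∫ τ in Ioc 0 t, C ^ 2 / lo * ∫ x, ‖w τ x‖ ^ 2 := by
          refine add_le_add (h0 N) (mul_le_mul_of_nonneg_left ?_ (by norm_num))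
          refine integral_mono_ae hsumI ((hE2.mono_set hsub).const_mul _) ?_
          exact (ae_restrict_iff' measurableSet_Ioc).2 ((hbound' N).mono fun τ hτ hτI => hτ (hsub hτI))
      _ ≤ (∫ x, ‖w₀ x‖ ^ 2) + 2 * ∫ τ in Ioo 0 T, C ^ 2 / lo * ∫ x, ‖w τ x‖ ^ 2 := by
          refine add_le_add le_rfl (mul_le_mul_of_nonneg_left ?_ (by norm_num))
          exact setIntegral_mono_set (hE2.const_mul _)
            (ae_of_all _ fun τ => mul_nonneg (by positivity) (integral_nonneg fun x => sq_nonneg _)) hsub.eventuallyLE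
      _ = (∫ x, ‖w₀ x‖ ^ 2) + 2 * (C ^ 2 / lo) * ∫ p, ‖uncurry w p‖ ^ 2 ∂μ := by
          rw [integral_const_mul, hE2eq, mul_assoc]
  -- pass to the limit `N → ∞`
  exact le_of_tendsto' (tendsto_integral_inner_fourierTruncate_self h2) hEN

end L2Bound

end Torus

end Literature.Analysis.FluidPDE

end
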